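import Mathlib
import Literature.MathematicalPhysics.QuantumFieldTheory.Balaban1983to89.TreeLength
import Literature.MathematicalPhysics.QuantumFieldTheory.Balaban1983to89.B16SupCountFloor
import Literature.MathematicalPhysics.QuantumFieldTheory.Balaban1983to89.B13Geometry236Printed

/-!
# `Balaban1983to89.B16.SupCountCeiling` — upper cube counts in the cell's typed (SUP-metric) tree-length model: slope
2(2^d − 1) for every connected polygonal graph (parity shells) and the SHARP slope 2^d − 1 for polygonal paths
(a discrete potential)

CITATION HEADER (lean-in-tree rule 2026-08-18).  Sources: T. Bałaban, *Large field renormalization. II. Localization,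
exponentiation, and bounds for the 𝐑 operation*, Commun. Math. Phys. **122**, 355–392 (1989) [Balaban1989LargeFieldII]
(cell paper B16; held `paper:balaban1989-cmp122-large-field-ii`, journal page = PDF page + 354): p. 385 [PDF 31] prints the
count of M-cubes met by a tree graph as «7^d(3·2^{d−1}d′₁(Z₁^{(i)}) + 2^d)» (slope 3·2^{d−1}, additive 2^d), and (1.93)
p. 388 [PDF 34] uses the reciprocal constant (3·2^d)^{−1}; T. Bałaban, *Renormalization group approach to lattice gauge
field theories. I*, Commun. Math. Phys. **109**, 249–301 (1987) [Balaban1987RG1] p. 257 (linear size d_j; no metric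
named — cell DIVERGENCE.md D-T2); J. Dimock, *The renormalization group according to Bałaban II. Large fields*, J. Math.
Phys. **54**, 092301 (2013), arXiv:1212.5562v2 [Dimock2013BalabanII] App. E (sup-metric convention; Lemma E.1 (3)
«|Y|_M ≤ 4(2^d + 1)(ℓ_M(Y) + 1)», the shape of the in-tree count).  The Bałaban papers are manuscripts UNDER ADJUDICATION
by the audit cell `pub-balaban`: nothing printed in them is asserted here; every `theorem` below is an elementary statement
of the typed model, proved without `sorry` and without new axioms.  NEW leaf module of unit `b2b-balaban-b01` (gen 22;
cell records GAPS.md C-b01g22-2, DIVERGENCE.md D-b01g15.1); it imports `…TreeLength` (unit pv22),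
`…B16.SupCountFloor` (unit b01, gen 15) and `…B13Geometry236Printed` (only for its segment-parametrisation complements
`gam_zero`, `gam_one`, `gam_sub_gam`, `dist_gam_gam`) and modifies nothing.  Nearest statement in print located by the cell's presearch:
the d = 2 EUCLIDEAN pixel count of Y. Gerard, A. Vacavant, J.-M. Favreau, *Tight bounds in the quadtree complexity
theorem and the maximal number of pixels crossed by a curve of given length*, Theoret. Comput. Sci. **624** (2016) 41–55,
doi:10.1016/j.tcs.2015.12.015 (not used: other metric, d = 2); the statements below are tagged [folklore].

THE TYPED MODEL (`…TreeLength`): closed unit cubes `cube y = [y, y + 1]^d`, y ∈ ℤ^d, of ℝ^d with Mathlib's SUP metric;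
a polygonal graph is a list T of segments, `len T` the sum of their sup-lengths, `carrier T` their union;
`SAdmissible Y T` = the carrier is connected and meets every cube of Y.

WHAT IS PROVED (d arbitrary unless stated).
(M) CONNECTED GRAPHS, slope 2(2^d − 1).  `card_le_two_mul_sub`: `SAdmissible Y T → #Y ≤ 2(2^d − 1)·len T + 2^d`; at
  d = 4 `#Y ≤ 30·len T + 16` (`card_le_four`), against the in-tree `TreeLength.card_le_of_sAdmissible_len`
  `#Y ≤ 2^d(4·len T + 1)` (= 64·len T + 16 at d = 4); Steiner form `card_le_steinerLen_two_mul_sub`: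
  `#Y ≤ 2(2^d − 1)·ℓ̃(Y) + 2^d` (Y ≠ ∅); `slope_bracket`: with the floor of `B16.SupCountFloor.count_floor` the optimal slope
  c_d of a count `#Y ≤ c·len T + 2^d` valid for all connected graphs satisfies 2^d − 1 ≤ c_d ≤ 2(2^d − 1) (d ≥ 1).
  ARGUMENT (parity shells, Parts 1–5).  Index cubes by the class `cls y = y mod 2 ∈ (ℤ/2)^d` (2^d classes).  Two distinct
  cubes of one class differ by ≥ 2 in some coordinate, so a point of one is at sup-distance ≥ 3/2 from the centre of the
  other (`three_halves_le_dist_ctr`) and the centres are ≥ 2 apart (`two_le_dist_ctr`).  Around each cube y put the closed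
  shell `shell δ y = {½ + δ ≤ dist(·, centre y) ≤ 1 − δ}` (δ > 0).  MULTIPLICITY (`card_filter_mem_shell_le`): a point of
  ℝ^d lies in the shells of at most 2^d − 1 cubes of Y — at most one per class, none of the class of its own lattice cube
  ⌊p⌋.  CAPTURE (`capture_shell`): if the connected carrier meets `cube y` and a point at distance ≥ 1 from its centre —
  automatic once the class of y holds a second cube of Y — the length of T inside `shell δ y` is ≥ ½ − 2δ (the 1-Lipschitz
  distance-to-centre maps that part of T onto [½ + δ, 1 − δ]: `LipschitzOnWith.hausdorffMeasure_image_le` +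
  `MeasureTheory.hausdorffMeasure_real`).  SUMMATION (`sum_lenIn_le_mul_len`, a bounded-multiplicity version of pv22's
  `sum_lenIn_le_len`, from `measure_sum_le_of_multiplicity`): Σ_y lenIn(shell δ y) T ≤ (2^d − 1)·len T.  So
  (½ − 2δ)·#Y₂ ≤ (2^d − 1)·len T for the cubes Y₂ of Y whose class holds ≥ 2 cubes of Y (`shell_ineq`), δ ↓ 0, and the
  other cubes are ≤ one per class (`card_filter_alone_le`).
(P) PATHS, the sharp slope 2^d − 1.  `IsPath T` (consecutive segments share an endpoint); `card_le_of_isPath`,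
  `card_le_of_isPath_sAdmissible`: a polygonal path meets at most (2^d − 1)·len T + 2^d cubes; d = 4: `15·len T + 16`
  (`card_le_of_isPath_four`); `path_slope_sharp`: no smaller slope is valid even for paths (the unit diagonal of
  `B16.SupCountFloor` is a one-segment path with 2^{d+1} − 1 cubes), so for PATHS the optimal slope is exactly 2^d − 1 —
  below the printed 3·2^{d−1}.
  ARGUMENT (discrete potential, Parts 6–10).  For a finite set V of «visited» cubes put
  Φ(x, V) = Σ_ε term_ε(x, V), term_ε(x, V) = min(1, sup-dist(x, cubes of V of class ε)) (1 if none) (`term`, `pot`); each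
  term is 1-Lipschitz (`term_le_term_add_dist`).  ONE STEP (`one_step`): for a, b in one lattice cube z₀ with
  V ⊇ cubesAt a, #(cubesAt b ∖ V) + Φ(b, V ∪ cubesAt b) ≤ Φ(a, V) + (2^d − 1)·dist(a, b) — the class of z₀ has term 0 at a
  and at b, every NEW cube at b has (by the separation) term exactly 1 at b before and 0 after, and distinct cubes at one
  point have distinct classes (`cls_injOn_cubesAt`).  ONE SEGMENT (`seg_step`, via `seg_aux`): cut [x, y] at the finitely
  many parameters where a moving coordinate is an integer (`events`); consecutive cut points lie in a common cube
  (`exists_common_cube_gam`) and the cubes met in between already contain a cut point (`mem_cube_endpoints`); telescope.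
  START (`card_cubesAt_add_pot`): #cubesAt(x₀) + Φ(x₀, cubesAt x₀) = 2^d.  Along a path (`path_aux`) the visited set
  absorbs every met cube and #V + Φ never exceeds 2^d + (2^d − 1)·(length so far).
WHAT IS *NOT* PROVED: the conjectured sharp slope 2^d − 1 for connected graphs that are not paths (trees with branch
points) — OPEN in the cell (D-b01g15.1): doubling a tree into a closed path only returns (M); the printed slope 3·2^{d−1}
(24 at d = 4) lies inside the proved tree bracket [15, 30] at d = 4, so this module does NOT decide whether the printed
constant holds verbatim for trees in the sup typing (by GAPS C-b01g15-3 A1 the slope is not load-bearing for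
(1.93)/(1.97): any linear count with additive 2^d suffices after constant chasing).  Value: kernel-checked bookkeeping —
an explicit constant of the typed model halved for trees and settled for paths — NOT summit progress, NOT a claim about
the manuscripts.
-/

namespace Literature.MathematicalPhysics.QuantumFieldTheory.Balaban1983to89.B16.SupCountCeiling

noncomputable section

open Literature.MathematicalPhysics.QuantumFieldTheory.Balaban1983to89.B13ScaleTransfer (Pt)
open Literature.MathematicalPhysics.QuantumFieldTheory.Balaban1983to89.TreeLength
open MeasureTheory
open scoped ENNReal NNReal

variable {d : ℕ}

/-! ## Part 1. Parity classes of cubes, centres, separation -/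

/-- The parity class `y mod 2 ∈ (ℤ/2ℤ)^d` of a cube index y ∈ ℤ^d. [folklore] -/
def cls (y : Pt d) : Fin d → ZMod 2 := fun i => ((y i : ℤ) : ZMod 2)

/-- There are 2^d parity classes. [folklore] -/
theorem card_classes : Fintype.card (Fin d → ZMod 2) = 2 ^ d := by
  simp [ZMod.card]

/-- Two distinct cubes of one parity class differ by at least 2 in some coordinate. [folklore] -/
theorem exists_two_le_of_cls_eq {y y' : Pt d} (hc : cls y = cls y') (hne : y ≠ y') :
    ∃ i, (2 : ℤ) ≤ |y i - y' i| := by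
  obtain ⟨i, hi⟩ : ∃ i, y i ≠ y' i := by
    by_contra h
    push Not at h
    exact hne (funext h)
  refine ⟨i, ?_⟩
  have h2 : (2 : ℤ) ∣ y' i - y i := by
    have hci : ((y i : ℤ) : ZMod 2) = ((y' i : ℤ) : ZMod 2) := congr_fun hc i
    exact (ZMod.intCast_eq_intCast_iff_dvd_sub (y i) (y' i) 2).1 hci
  obtain ⟨k, hk⟩ := h2
  have hk0 : k ≠ 0 := by
    rintro rfl
    simp only [mul_zero, sub_eq_zero] at hk
    exact hi hk.symm
  have h1 : (1 : ℤ) ≤ |k| := Int.one_le_abs hk0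
  have : |y i - y' i| = 2 * |k| := by
    rw [abs_sub_comm, hk, abs_mul]
    norm_num
  rw [this]
  linarith

/-- The centre (y_μ + ½)_μ of the cube of index y. [folklore] -/
def ctr (y : Pt d) : RPt d := fun i => (y i : ℝ) + 1 / 2

/-- A unit cube is the closed sup-ball of radius ½ about its centre. [folklore] -/
theorem mem_cube_iff_dist_ctr {y : Pt d} {p : RPt d} : p ∈ cube y ↔ dist p (ctr y) ≤ 1 / 2 := by
  rw [mem_cube, dist_pi_le_iff (by norm_num : (0 : ℝ) ≤ 1 / 2)]
  refine forall_congr' fun i => ?_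
  rw [Real.dist_eq, ctr, abs_le]
  constructor
  · rintro ⟨h1, h2⟩; constructor <;> linarith
  · rintro ⟨h1, h2⟩; constructor <;> linarith

/-- SEPARATION: a point of a cube is at sup-distance ≥ 3/2 from the centre of any OTHER cube of the same class. [folklore] -/
theorem three_halves_le_dist_ctr {y y' : Pt d} (hc : cls y = cls y') (hne : y ≠ y') {p : RPt d}
    (hp : p ∈ cube y) : 3 / 2 ≤ dist p (ctr y') := by
  obtain ⟨i, hi⟩ := exists_two_le_of_cls_eq hc hne
  obtain ⟨h1, h2⟩ := mem_cube.1 hp i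
  have hi' : (2 : ℝ) ≤ |(y i : ℝ) - (y' i : ℝ)| := by exact_mod_cast hi
  calc (3 : ℝ) / 2 ≤ dist (p i) (ctr y' i) := by
        rw [Real.dist_eq, ctr]
        rcases le_abs.1 hi' with h | h
        · exact le_abs.2 (Or.inl (by linarith))
        · exact le_abs.2 (Or.inr (by linarith))
    _ ≤ dist p (ctr y') := dist_le_pi_dist p (ctr y') i

/-- SEPARATION of centres: two distinct cubes of one class have centres at sup-distance ≥ 2. [folklore] -/
theorem two_le_dist_ctr {y y' : Pt d} (hc : cls y = cls y') (hne : y ≠ y') : 2 ≤ dist (ctr y) (ctr y') := by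
  obtain ⟨i, hi⟩ := exists_two_le_of_cls_eq hc hne
  have hi' : (2 : ℝ) ≤ |(y i : ℝ) - (y' i : ℝ)| := by exact_mod_cast hi
  calc (2 : ℝ) ≤ dist (ctr y i) (ctr y' i) := by
        rw [Real.dist_eq, ctr, ctr]
        simpa using hi'
    _ ≤ dist (ctr y) (ctr y') := dist_le_pi_dist (ctr y) (ctr y') i

/-- The lattice cube ⌊p⌋ of a point. [folklore] -/
def zOf (p : RPt d) : Pt d := fun i => ⌊p i⌋

/-- Every point lies in its lattice cube ⌊p⌋. [folklore] -/
theorem mem_cube_zOf (p : RPt d) : p ∈ cube (zOf p) :=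
  mem_cube.2 fun i => ⟨Int.floor_le (p i), (Int.lt_floor_add_one (p i)).le⟩

/-! ## Part 2. Shells and their multiplicity -/

/-- The closed shell {½ + δ ≤ dist(·, centre y) ≤ 1 − δ} around the cube y. [folklore] -/
def shell (δ : ℝ) (y : Pt d) : Set (RPt d) := (fun p => dist p (ctr y)) ⁻¹' Set.Icc (1 / 2 + δ) (1 - δ)

/-- Membership in a shell. [folklore] -/
theorem mem_shell {δ : ℝ} {y : Pt d} {p : RPt d} :
    p ∈ shell δ y ↔ 1 / 2 + δ ≤ dist p (ctr y) ∧ dist p (ctr y) ≤ 1 - δ := Iff.rfl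

/-- Shells are closed. [folklore] -/
theorem isClosed_shell (δ : ℝ) (y : Pt d) : IsClosed (shell δ y) :=
  isClosed_Icc.preimage (continuous_id.dist continuous_const)

/-- OWN CLASS IS FREE: a point of a cube z lies in no shell of a cube of the class of z (δ > 0). [folklore] -/
theorem not_mem_shell_of_cls_eq {δ : ℝ} (hδ : 0 < δ) {z y : Pt d} (hc : cls y = cls z) {p : RPt d}
    (hp : p ∈ cube z) : p ∉ shell δ y := by
  intro h
  obtain ⟨h1, h2⟩ := mem_shell.1 h
  rcases eq_or_ne z y with rfl | hne
  · have := mem_cube_iff_dist_ctr.1 hp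
    linarith
  · have := three_halves_le_dist_ctr hc.symm hne hp
    linarith

/-- AT MOST ONE PER CLASS: a point lies in the shells of at most one cube of each class (δ > 0). [folklore] -/
theorem eq_of_mem_shell {δ : ℝ} (hδ : 0 < δ) {y y' : Pt d} (hc : cls y = cls y') {p : RPt d}
    (hp : p ∈ shell δ y) (hp' : p ∈ shell δ y') : y = y' := by
  by_contra hne
  have h2 := two_le_dist_ctr hc hne
  have := dist_triangle_left (ctr y) (ctr y') p
  have hy := (mem_shell.1 hp).2
  have hy' := (mem_shell.1 hp').2
  linarith

open scoped Classical in
/-- MULTIPLICITY: a point of ℝ^d lies in the shells of at most 2^d − 1 cubes of any finite family Y (δ > 0): the class map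
is injective on the cubes whose shell contains p and misses the class of ⌊p⌋. [folklore] -/
theorem card_filter_mem_shell_le {δ : ℝ} (hδ : 0 < δ) (Y : Finset (Pt d)) (p : RPt d) :
    ((Y.filter fun y => p ∈ shell δ y).card : ℝ) ≤ 2 ^ d - 1 := by
  classical
  set F := Y.filter fun y => p ∈ shell δ y with hF
  have hinj : Set.InjOn cls (F : Set (Pt d)) := by
    intro y hy y' hy' hcc
    have hy1 := (Finset.mem_filter.1 (Finset.mem_coe.1 hy)).2
    have hy2 := (Finset.mem_filter.1 (Finset.mem_coe.1 hy')).2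
    exact eq_of_mem_shell hδ hcc hy1 hy2
  have hmiss : F.image cls ⊆ Finset.univ.erase (cls (zOf p)) := by
    intro c hc
    rw [Finset.mem_erase]
    refine ⟨?_, Finset.mem_univ _⟩
    obtain ⟨y, hy, rfl⟩ := Finset.mem_image.1 hc
    intro hcz
    exact not_mem_shell_of_cls_eq hδ hcz (mem_cube_zOf p) (Finset.mem_filter.1 hy).2
  have hcard : F.card ≤ 2 ^ d - 1 := by
    calc F.card = (F.image cls).card := (Finset.card_image_of_injOn hinj).symm
      _ ≤ (Finset.univ.erase (cls (zOf p))).card := Finset.card_le_card hmiss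
      _ = 2 ^ d - 1 := by rw [Finset.card_erase_of_mem (Finset.mem_univ _), Finset.card_univ, card_classes]
  have h1 : (1 : ℕ) ≤ 2 ^ d := Nat.one_le_two_pow
  have : (F.card : ℝ) ≤ ((2 ^ d - 1 : ℕ) : ℝ) := by exact_mod_cast hcard
  rw [Nat.cast_sub h1] at this
  simpa using this

/-! ## Part 3. Lengths inside regions of bounded multiplicity -/

open scoped Classical in
/-- MEASURE UNDER BOUNDED MULTIPLICITY: if measurable sets P_k ⊆ S cover each point of S at most m times, then
Σ_k μ(P_k) ≤ m · μ(S). [folklore] -/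
theorem measure_sum_le_of_multiplicity {α ι : Type*} [MeasurableSpace α] (μ : Measure α) (K : Finset ι)
    (P : ι → Set α) (S : Set α) (hS : MeasurableSet S) (hP : ∀ k ∈ K, MeasurableSet (P k))
    (hPS : ∀ k ∈ K, P k ⊆ S) (m : ℕ) (hmult : ∀ x ∈ S, ((K.filter fun k => x ∈ P k).card) ≤ m) :
    ∑ k ∈ K, μ (P k) ≤ m * μ S := by
  classical
  have h1 : ∑ k ∈ K, μ (P k) = ∫⁻ x, ∑ k ∈ K, (P k).indicator (1 : α → ℝ≥0∞) x ∂μ := by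
    rw [lintegral_finsetSum _ fun k hk => (measurable_one.indicator (hP k hk))]
    refine Finset.sum_congr rfl fun k hk => ?_
    rw [lintegral_indicator_one (hP k hk)]
  have h2 : ∀ x, ∑ k ∈ K, (P k).indicator (1 : α → ℝ≥0∞) x ≤ S.indicator (fun _ => (m : ℝ≥0∞)) x := by
    intro x
    have hsum : ∑ k ∈ K, (P k).indicator (1 : α → ℝ≥0∞) x = ((K.filter fun k => x ∈ P k).card : ℝ≥0∞) := by
      rw [Finset.card_filter]
      push_cast
      refine Finset.sum_congr rfl fun k _ => ?_
      by_cases hx : x ∈ P k <;> simp [hx]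
    rw [hsum]
    by_cases hxS : x ∈ S
    · rw [Set.indicator_of_mem hxS]
      exact_mod_cast hmult x hxS
    · have h0 : (K.filter fun k => x ∈ P k) = ∅ := by
        rw [Finset.filter_eq_empty_iff]
        intro k hk hx
        exact hxS (hPS k hk hx)
      rw [h0, Set.indicator_of_notMem hxS]
      simp
  calc ∑ k ∈ K, μ (P k) = ∫⁻ x, ∑ k ∈ K, (P k).indicator (1 : α → ℝ≥0∞) x ∂μ := h1
    _ ≤ ∫⁻ x, S.indicator (fun _ => (m : ℝ≥0∞)) x ∂μ := lintegral_mono h2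
    _ = m * μ S := lintegral_indicator_const hS _

open scoped Classical in
/-- ADDITIVITY UNDER BOUNDED MULTIPLICITY: if the closed regions B_k cover each point of ℝ^d at most m times, then
Σ_k (length of T inside B_k) ≤ m · |T| (a multiplicity version of `TreeLength.sum_lenIn_le_len`). [folklore] -/
theorem sum_lenIn_le_mul_len {ι : Type*} (K : Finset ι) (B : ι → Set (RPt d)) (hB : ∀ k ∈ K, IsClosed (B k))
    (m : ℕ) (hmult : ∀ p : RPt d, (K.filter fun k => p ∈ B k).card ≤ m) (T : List (Seg d)) :
    ∑ k ∈ K, lenIn (B k) T ≤ m * len T := by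
  classical
  induction T with
  | nil => simp
  | cons s T ih =>
    simp only [lenIn_cons, len_cons, Finset.sum_add_distrib]
    have h1 : ∑ k ∈ K, (volume (paramIn (B k) s)).toReal ≤ m := by
      rw [← ENNReal.toReal_sum (fun k _ => volume_paramIn_ne_top (B k) s)]
      have hle : ∑ k ∈ K, volume (paramIn (B k) s) ≤ m * volume (Set.Icc (0 : ℝ) 1) := by
        refine measure_sum_le_of_multiplicity volume K (fun k => paramIn (B k) s) (Set.Icc 0 1)
          measurableSet_Icc (fun k hk => (isClosed_paramIn (hB k hk) s).measurableSet)
          (fun k _ => paramIn_subset_Icc (B k) s) m fun t _ => ?_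
        calc (K.filter fun k => t ∈ paramIn (B k) s).card ≤ (K.filter fun k => gam s t ∈ B k).card := by
              refine Finset.card_le_card fun k hk => ?_
              rw [Finset.mem_filter] at hk ⊢
              exact ⟨hk.1, hk.2.2⟩
          _ ≤ m := hmult (gam s t)
      rw [Real.volume_Icc, sub_zero, ENNReal.ofReal_one, mul_one] at hle
      have : (∑ k ∈ K, volume (paramIn (B k) s)).toReal ≤ ((m : ℝ≥0∞)).toReal :=
        ENNReal.toReal_mono (ENNReal.natCast_ne_top m) hle
      simpa using this
    have hs : ∑ k ∈ K, dist s.1 s.2 * (volume (paramIn (B k) s)).toReal ≤ m * dist s.1 s.2 := by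
      rw [← Finset.mul_sum]
      calc dist s.1 s.2 * ∑ k ∈ K, (volume (paramIn (B k) s)).toReal ≤ dist s.1 s.2 * m :=
            mul_le_mul_of_nonneg_left h1 dist_nonneg
        _ = m * dist s.1 s.2 := mul_comm _ _
    calc ∑ k ∈ K, dist s.1 s.2 * (volume (paramIn (B k) s)).toReal + ∑ k ∈ K, lenIn (B k) T
        ≤ m * dist s.1 s.2 + m * len T := add_le_add hs ih
      _ = m * (dist s.1 s.2 + len T) := by ring

/-! ## Part 4. Capture in a shell (Lebesgue measure of a Lipschitz image) -/

/-- The parametrisation of a segment is Lipschitz with constant its sup-length. [folklore] -/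
theorem lipschitzWith_gam (s : Seg d) : LipschitzWith (nndist s.1 s.2) (gam s) := by
  refine LipschitzWith.of_dist_le_mul fun t t' => ?_
  rw [B13Geometry236Printed.dist_gam_gam, coe_nndist, Real.dist_eq, abs_sub_comm, mul_comm]

/-- The union over the segments s of T of the images g(γ_s(paramIn B s)), i.e. of g(s ∩ B) (list-indexed union). [folklore] -/
def imgU (g : RPt d → ℝ) (B : Set (RPt d)) : List (Seg d) → Set ℝ
  | [] => ∅
  | s :: T => (fun t => g (gam s t)) '' paramIn B s ∪ imgU g B T

/-- Membership in `imgU`. [folklore] -/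
theorem mem_imgU {g : RPt d → ℝ} {B : Set (RPt d)} {T : List (Seg d)} {v : ℝ} :
    v ∈ imgU g B T ↔ ∃ s ∈ T, v ∈ (fun t => g (gam s t)) '' paramIn B s := by
  induction T with
  | nil => simp [imgU]
  | cons s T ih =>
    simp only [imgU, Set.mem_union, ih, List.mem_cons, exists_eq_or_imp]

/-- For a 1-Lipschitz g, the images g(s ∩ B) have total Lebesgue measure at most the length of T inside B. [folklore] -/
theorem volume_imgU_le {g : RPt d → ℝ} (hg : LipschitzWith 1 g) (B : Set (RPt d)) (T : List (Seg d)) :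
    volume (imgU g B T) ≤ ENNReal.ofReal (lenIn B T) := by
  induction T with
  | nil => simp [imgU]
  | cons s T ih =>
    rw [imgU, lenIn_cons, ENNReal.ofReal_add (by positivity) (lenIn_nonneg B T)]
    refine (measure_union_le _ _).trans (add_le_add ?_ ih)
    have hL : LipschitzWith (nndist s.1 s.2) (fun t => g (gam s t)) := by
      have := hg.comp (lipschitzWith_gam s)
      simpa [Function.comp_def] using this
    have h1 : volume ((fun t => g (gam s t)) '' paramIn B s) ≤ (nndist s.1 s.2 : ℝ≥0∞) * volume (paramIn B s) := by
      have h := (hL.lipschitzOnWith (s := paramIn B s)).hausdorffMeasure_image_le zero_le_one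
      rw [ENNReal.rpow_one, hausdorffMeasure_real] at h
      exact h
    calc volume ((fun t => g (gam s t)) '' paramIn B s) ≤ (nndist s.1 s.2 : ℝ≥0∞) * volume (paramIn B s) := h1
      _ = ENNReal.ofReal (dist s.1 s.2) * volume (paramIn B s) := by
          rw [← edist_nndist, edist_dist]
      _ = ENNReal.ofReal (dist s.1 s.2 * (volume (paramIn B s)).toReal) := by
          rw [ENNReal.ofReal_mul dist_nonneg, ENNReal.ofReal_toReal (volume_paramIn_ne_top B s)]

/-- CAPTURE IN A SHELL: if the carrier of T is preconnected, meets the cube y and contains a point at sup-distance ≥ 1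
from its centre, then for δ ≥ 0 the length of T inside `shell δ y` is at least ½ − 2δ. [folklore] -/
theorem capture_shell {T : List (Seg d)} (hT : IsPreconnected (carrier T)) {y : Pt d} {p q : RPt d}
    (hp : p ∈ carrier T) (hpy : p ∈ cube y) (hq : q ∈ carrier T) (hqy : 1 ≤ dist q (ctr y))
    {δ : ℝ} (hδ : 0 ≤ δ) : 1 / 2 - 2 * δ ≤ lenIn (shell δ y) T := by
  set g : RPt d → ℝ := fun x => dist x (ctr y) with hg
  have hg1 : LipschitzWith 1 g := LipschitzWith.dist_left (ctr y)
  have hpy' : g p ≤ 1 / 2 := mem_cube_iff_dist_ctr.1 hpy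
  have hsub : Set.Icc (1 / 2 + δ) (1 - δ) ⊆ imgU g (shell δ y) T := by
    intro v hv
    have hpc : IsPreconnected (g '' carrier T) := hT.image g hg1.continuous.continuousOn
    have hvI : v ∈ Set.Icc (g p) (g q) := ⟨by linarith [hv.1], by linarith [hv.2, hqy]⟩
    obtain ⟨x, hx, hxv⟩ := hpc.Icc_subset ⟨p, hp, rfl⟩ ⟨q, hq, rfl⟩ hvI
    obtain ⟨s, hs, hxs⟩ := mem_carrier.1 hx
    rw [segment_eq_image_gam] at hxs
    obtain ⟨t, ht, rfl⟩ := hxs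
    refine mem_imgU.2 ⟨s, hs, t, ⟨ht, ?_⟩, hxv⟩
    show gam s t ∈ shell δ y
    rw [mem_shell]
    change g (gam s t) = v at hxv
    rw [hg] at hxv
    simp only at hxv
    rw [hxv]
    exact hv
  have h1 : ENNReal.ofReal (1 / 2 - 2 * δ) ≤ volume (Set.Icc (1 / 2 + δ) (1 - δ)) := by
    rw [Real.volume_Icc]
    exact ENNReal.ofReal_le_ofReal (by linarith)
  have h2 : volume (Set.Icc (1 / 2 + δ) (1 - δ)) ≤ ENNReal.ofReal (lenIn (shell δ y) T) :=
    (measure_mono hsub).trans (volume_imgU_le hg1 _ T)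
  exact (ENNReal.ofReal_le_ofReal_iff (lenIn_nonneg _ T)).1 (h1.trans h2)

/-! ## Part 5. The count -/

open scoped Classical in
/-- THE SHELL INEQUALITY: for a Steiner-admissible T and δ > 0, (½ − 2δ)·#Y₂ ≤ (2^d − 1)·|T|, where Y₂ ⊆ Y is the
set of cubes of Y whose parity class contains a second cube of Y. [folklore] -/
theorem shell_ineq {Y : Finset (Pt d)} {T : List (Seg d)} (hT : SAdmissible Y T) {δ : ℝ} (hδ : 0 < δ) :
    (1 / 2 - 2 * δ) * ((Y.filter fun y => ∃ y' ∈ Y, y' ≠ y ∧ cls y' = cls y).card : ℝ) ≤ (2 ^ d - 1) * len T := by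
  classical
  set Y₂ := Y.filter fun y => ∃ y' ∈ Y, y' ≠ y ∧ cls y' = cls y with hY₂
  have hcap : ∀ y ∈ Y₂, 1 / 2 - 2 * δ ≤ lenIn (shell δ y) T := by
    intro y hy
    obtain ⟨hyY, y', hy'Y, hne, hc⟩ := Finset.mem_filter.1 hy
    obtain ⟨p, hp, hpy⟩ := hT.meets y hyY
    obtain ⟨q, hq, hqy'⟩ := hT.meets y' hy'Y
    have hfar : 1 ≤ dist q (ctr y) := by
      have := three_halves_le_dist_ctr hc hne hqy'
      linarith
    exact capture_shell hT.connected.isPreconnected hp hpy hq hfar hδ.le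
  have hsum : ∑ y ∈ Y₂, lenIn (shell δ y) T ≤ ((2 ^ d - 1 : ℕ) : ℝ) * len T := by
    refine sum_lenIn_le_mul_len Y₂ (fun y => shell δ y) (fun y _ => isClosed_shell δ y) (2 ^ d - 1) ?_ T
    intro p
    have h := card_filter_mem_shell_le hδ Y₂ p
    have h1 : (1 : ℕ) ≤ 2 ^ d := Nat.one_le_two_pow
    have : ((Y₂.filter fun y => p ∈ shell δ y).card : ℝ) ≤ ((2 ^ d - 1 : ℕ) : ℝ) := by
      rw [Nat.cast_sub h1]; simpa using h
    exact_mod_cast this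
  have h1 : (1 : ℕ) ≤ 2 ^ d := Nat.one_le_two_pow
  rw [Nat.cast_sub h1] at hsum
  simp only [Nat.cast_pow, Nat.cast_ofNat, Nat.cast_one] at hsum
  calc (1 / 2 - 2 * δ) * (Y₂.card : ℝ) = ∑ y ∈ Y₂, (1 / 2 - 2 * δ) := by
        rw [Finset.sum_const, nsmul_eq_mul, mul_comm]
    _ ≤ ∑ y ∈ Y₂, lenIn (shell δ y) T := Finset.sum_le_sum hcap
    _ ≤ (2 ^ d - 1) * len T := hsum

open scoped Classical in
/-- THE CUBES ALONE IN THEIR CLASS are at most 2^d (the class map is injective on them). [folklore] -/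
theorem card_filter_alone_le (Y : Finset (Pt d)) :
    ((Y.filter fun y => ¬ ∃ y' ∈ Y, y' ≠ y ∧ cls y' = cls y).card : ℝ) ≤ 2 ^ d := by
  classical
  set Y₁ := Y.filter fun y => ¬ ∃ y' ∈ Y, y' ≠ y ∧ cls y' = cls y with hY₁
  have hinj : Set.InjOn cls (Y₁ : Set (Pt d)) := by
    intro y hy y' hy' hcc
    have hy1 := Finset.mem_filter.1 (Finset.mem_coe.1 hy)
    have hy2 := Finset.mem_filter.1 (Finset.mem_coe.1 hy')
    by_contra hne
    exact hy1.2 ⟨y', hy2.1, Ne.symm hne, hcc.symm⟩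
  have : Y₁.card ≤ 2 ^ d := by
    calc Y₁.card = (Y₁.image cls).card := (Finset.card_image_of_injOn hinj).symm
      _ ≤ (Finset.univ : Finset (Fin d → ZMod 2)).card := Finset.card_le_card (Finset.subset_univ _)
      _ = 2 ^ d := by rw [Finset.card_univ, card_classes]
  exact_mod_cast this

/-- THE LINEAR VOLUME BOUND WITH SLOPE 2(2^d − 1): if T is Steiner-admissible for Y then
#Y ≤ 2(2^d − 1)·|T| + 2^d (sup metric; in-tree before this module: 4·2^d·|T| + 2^d). [folklore] -/
theorem card_le_two_mul_sub {Y : Finset (Pt d)} {T : List (Seg d)} (hT : SAdmissible Y T) :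
    (Y.card : ℝ) ≤ 2 * (2 ^ d - 1) * len T + 2 ^ d := by
  classical
  set Y₂ := Y.filter fun y => ∃ y' ∈ Y, y' ≠ y ∧ cls y' = cls y with hY₂
  set Y₁ := Y.filter fun y => ¬ ∃ y' ∈ Y, y' ≠ y ∧ cls y' = cls y with hY₁
  have hsplit : (Y.card : ℝ) = Y₂.card + Y₁.card := by
    have := Finset.card_filter_add_card_filter_not (s := Y) (fun y => ∃ y' ∈ Y, y' ≠ y ∧ cls y' = cls y)
    rw [← this]
    push_cast
    rfl
  have hℓ := len_nonneg T
  have h2d : (1 : ℝ) ≤ 2 ^ d := one_le_pow₀ (by norm_num)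
  have hA : (Y₂.card : ℝ) ≤ 2 * (2 ^ d - 1) * len T := by
    refine le_of_forall_pos_le_add fun ε hε => ?_
    set A : ℝ := (Y₂.card : ℝ) with hA
    have hA0 : 0 ≤ A := by positivity
    set δ : ℝ := ε / (4 * A + 4) with hδ
    have hδpos : 0 < δ := by positivity
    have hmain := shell_ineq hT hδpos
    have hδA : 4 * δ * A ≤ ε := by
      have h4 : 0 < 4 * A + 4 := by positivity
      calc 4 * δ * A = ε * (4 * A / (4 * A + 4)) := by rw [hδ]; ring
        _ ≤ ε * 1 := by
            refine mul_le_mul_of_nonneg_left ?_ hε.le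
            rw [div_le_one h4]; linarith
        _ = ε := mul_one ε
    -- from (1/2 - 2δ) A ≤ (2^d - 1) len T:  A ≤ 2 (2^d-1) len T + 4 δ A
    have : A = 2 * ((1 / 2 - 2 * δ) * A) + 4 * δ * A := by ring
    rw [this]
    linarith [hmain]
  have hB := card_filter_alone_le Y
  rw [hsplit]
  linarith [hA, hB]

/-- In d = 4: #Y ≤ 30·|T| + 16 for every Steiner-admissible T (in-tree before: 64·|T| + 16; printed slope behind
[Balaban1989LargeFieldII] (1.93): 24; floor: 15). [folklore] -/
theorem card_le_four {Y : Finset (Pt 4)} {T : List (Seg 4)} (hT : SAdmissible Y T) :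
    (Y.card : ℝ) ≤ 30 * len T + 16 := by
  have := card_le_two_mul_sub hT
  norm_num at this
  linarith

/-- THE BOUND FOR THE STEINER LENGTH: #Y ≤ 2(2^d − 1)·ℓ̃(Y) + 2^d for every non-empty Y. [folklore] -/
theorem card_le_steinerLen_two_mul_sub {Y : Finset (Pt d)} (hY : Y.Nonempty) :
    (Y.card : ℝ) ≤ 2 * (2 ^ d - 1) * steinerLen Y + 2 ^ d := by
  have h2d : (1 : ℝ) ≤ 2 ^ d := one_le_pow₀ (by norm_num)
  rcases eq_or_lt_of_le h2d with h1 | h1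
  · -- d = 0: 2^d = 1, one cube at most
    have hd : (2 : ℝ) ^ d - 1 = 0 := by linarith
    rw [hd]
    obtain ⟨T, hT⟩ := exists_sAdmissible hY
    have := card_le_two_mul_sub hT
    rw [hd] at this
    simpa using this
  · have hpos : (0 : ℝ) < 2 * (2 ^ d - 1) := by linarith
    have h : (Y.card - 2 ^ d) / (2 * (2 ^ d - 1)) ≤ steinerLen Y := by
      refine le_steinerLen (exists_sAdmissible hY) fun T hT => ?_
      have := card_le_two_mul_sub hT
      rw [div_le_iff₀ hpos]
      linarith
    rw [div_le_iff₀ hpos] at h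
    linarith

/-- THE SLOPE BRACKET at this module: any constant c valid in `SAdmissible Y T → #Y ≤ c·|T| + 2^d` (all Y, T; d ≥ 1)
is ≥ 2^d − 1 (`B16.SupCountFloor.count_floor`), and c = 2(2^d − 1) IS valid (`card_le_two_mul_sub`); the conjectured
sharp value 2^d − 1 and the printed 3·2^{d−1} both lie in the bracket. [folklore] -/
theorem slope_bracket (hd : 0 < d) :
    (∀ c : ℝ, (∀ (Y : Finset (Pt d)) (T : List (Seg d)), SAdmissible Y T → (Y.card : ℝ) ≤ c * len T + 2 ^ d) →
        (2 : ℝ) ^ d - 1 ≤ c) ∧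
      (∀ (Y : Finset (Pt d)) (T : List (Seg d)), SAdmissible Y T →
        (Y.card : ℝ) ≤ (2 * (2 ^ d - 1)) * len T + 2 ^ d) :=
  ⟨fun _ hc => SupCountFloor.count_floor hd hc, fun _ _ hT => card_le_two_mul_sub hT⟩

/-! ## Part 6. Paths — the cubes at a point and the common-cube endpoint lemma -/

/-- The (finite) set of lattice cubes containing the point b: the y with ⌈b_μ⌉ − 1 ≤ y_μ ≤ ⌊b_μ⌋. [folklore] -/
def cubesAt (b : RPt d) : Finset (Pt d) := Fintype.piFinset fun i => Finset.Icc (⌈b i⌉ - 1) ⌊b i⌋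

/-- `cubesAt b` is exactly the set of cubes containing b. [folklore] -/
theorem mem_cubesAt {b : RPt d} {y : Pt d} : y ∈ cubesAt b ↔ b ∈ cube y := by
  rw [cubesAt, Fintype.mem_piFinset, mem_cube]
  refine forall_congr' fun i => ?_
  rw [Finset.mem_Icc]
  constructor
  · rintro ⟨h1, h2⟩
    refine ⟨(Int.cast_le.2 h2).trans (Int.floor_le _), ?_⟩
    have h3 : ⌈b i⌉ ≤ y i + 1 := by omega
    have : (⌈b i⌉ : ℝ) ≤ (y i : ℝ) + 1 := by exact_mod_cast h3
    exact (Int.le_ceil _).trans this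
  · rintro ⟨h1, h2⟩
    refine ⟨?_, Int.le_floor.2 h1⟩
    have : ⌈b i⌉ ≤ y i + 1 := Int.ceil_le.2 (by push_cast; exact h2)
    omega

/-- Two distinct cubes containing one point have distinct parity classes. [folklore] -/
theorem cls_injOn_cubesAt (b : RPt d) : Set.InjOn cls (cubesAt b : Set (Pt d)) := by
  intro y hy y' hy' hc
  by_contra hne
  obtain ⟨i, hi⟩ := exists_two_le_of_cls_eq hc hne
  have h1 := mem_cube.1 (mem_cubesAt.1 (Finset.mem_coe.1 hy)) i
  have h2 := mem_cube.1 (mem_cubesAt.1 (Finset.mem_coe.1 hy')) i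
  have : |(y i : ℝ) - y' i| ≤ 1 := abs_sub_le_iff.2 ⟨by linarith [h1.1, h2.2], by linarith [h1.2, h2.1]⟩
  have hi' : (2 : ℝ) ≤ |(y i : ℝ) - y' i| := by exact_mod_cast hi
  linarith

/-- COMMON-CUBE ENDPOINT LEMMA: if a and b lie in one lattice cube, every cube met by the segment [a, b] already
contains a or b (a cube containing an interior point a + t(b − a), 0 ≤ t < 1, contains a). [folklore] -/
theorem mem_cube_endpoints {z₀ y : Pt d} {a b : RPt d} (ha : a ∈ cube z₀) (hb : b ∈ cube z₀) {t : ℝ}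
    (ht0 : 0 ≤ t) (ht1 : t ≤ 1) (hp : a + t • (b - a) ∈ cube y) : a ∈ cube y ∨ b ∈ cube y := by
  rcases eq_or_lt_of_le ht1 with rfl | ht1'
  · right
    simpa using hp
  left
  rw [mem_cube] at hp ⊢
  intro i
  obtain ⟨hp1, hp2⟩ := hp i
  obtain ⟨ha1, ha2⟩ := mem_cube.1 ha i
  obtain ⟨hb1, hb2⟩ := mem_cube.1 hb i
  simp only [Pi.add_apply, Pi.smul_apply, Pi.sub_apply, smul_eq_mul] at hp1 hp2
  constructor
  · by_contra h
    push Not at h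
    have hyz : z₀ i + 1 ≤ y i := by
      have : (z₀ i : ℝ) < y i := by linarith
      exact_mod_cast this
    have hyz' : (z₀ i : ℝ) + 1 ≤ y i := by exact_mod_cast hyz
    have h3 : 0 < t * (b i - a i) := by linarith
    have h4 : 0 < b i - a i := by
      by_contra h4
      push Not at h4
      have : t * (b i - a i) ≤ 0 := mul_nonpos_of_nonneg_of_nonpos ht0 h4
      linarith
    have h5 := mul_pos (sub_pos.2 ht1') h4
    nlinarith
  · by_contra h
    push Not at h
    have hyz : y i + 1 ≤ z₀ i := by
      have : (y i : ℝ) < z₀ i := by linarith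
      exact_mod_cast this
    have hyz' : (y i : ℝ) + 1 ≤ z₀ i := by exact_mod_cast hyz
    have h3 : t * (b i - a i) < 0 := by linarith
    have h4 : b i - a i < 0 := by
      by_contra h4
      push Not at h4
      have : 0 ≤ t * (b i - a i) := mul_nonneg ht0 h4
      linarith
    have h5 := mul_pos (sub_pos.2 ht1') (neg_pos.2 h4)
    nlinarith

/-! ## Part 7. Paths — the discrete potential Φ(x, V) = Σ_ε min(1, dist(x, V_ε)) -/

/-- The ε-term of the potential: min(1, inf-distance from x to the cubes of V of class ε) (= 1 if V has no cube of
class ε). [folklore] -/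
def term (ε : Fin d → ZMod 2) (x : RPt d) (V : Finset (Pt d)) : ℝ :=
  (insert (1 : ℝ) ((V.filter fun y => cls y = ε).image fun y => Metric.infDist x (cube y))).min'
    (Finset.insert_nonempty _ _)

/-- The potential Φ(x, V) = Σ_ε term_ε(x, V) over the 2^d parity classes. [folklore] -/
def pot (x : RPt d) (V : Finset (Pt d)) : ℝ := ∑ ε : Fin d → ZMod 2, term ε x V

variable {ε : Fin d → ZMod 2} {x x' : RPt d} {V W : Finset (Pt d)}

/-- term ≤ 1. [folklore] -/
theorem term_le_one : term ε x V ≤ 1 := Finset.min'_le _ _ (Finset.mem_insert_self _ _)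

/-- term ≤ the distance to any class-ε cube of V. [folklore] -/
theorem term_le_infDist {y : Pt d} (hy : y ∈ V) (hc : cls y = ε) : term ε x V ≤ Metric.infDist x (cube y) :=
  Finset.min'_le _ _ (Finset.mem_insert_of_mem (Finset.mem_image.2 ⟨y, Finset.mem_filter.2 ⟨hy, hc⟩, rfl⟩))

/-- Lower bounds for term: c ≤ term as soon as c ≤ 1 and c ≤ the distance to every class-ε cube of V. [folklore] -/
theorem le_term {c : ℝ} (hc1 : c ≤ 1) (h : ∀ y ∈ V, cls y = ε → c ≤ Metric.infDist x (cube y)) :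
    c ≤ term ε x V := by
  refine Finset.le_min' _ _ _ fun e he => ?_
  rcases Finset.mem_insert.1 he with rfl | he
  · exact hc1
  · obtain ⟨y, hy, rfl⟩ := Finset.mem_image.1 he
    exact h y (Finset.mem_filter.1 hy).1 (Finset.mem_filter.1 hy).2

/-- term ≥ 0. [folklore] -/
theorem term_nonneg : 0 ≤ term ε x V := le_term zero_le_one fun _ _ _ => Metric.infDist_nonneg

/-- term is attained: it is 1 or the distance to some class-ε cube of V. [folklore] -/
theorem term_cases (ε : Fin d → ZMod 2) (x : RPt d) (V : Finset (Pt d)) :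
    term ε x V = 1 ∨ ∃ y ∈ V, cls y = ε ∧ term ε x V = Metric.infDist x (cube y) := by
  have h := Finset.min'_mem (insert (1 : ℝ) ((V.filter fun y => cls y = ε).image fun y =>
    Metric.infDist x (cube y))) (Finset.insert_nonempty _ _)
  rcases Finset.mem_insert.1 h with h1 | h2
  · exact Or.inl h1
  · obtain ⟨y, hy, hyeq⟩ := Finset.mem_image.1 h2
    exact Or.inr ⟨y, (Finset.mem_filter.1 hy).1, (Finset.mem_filter.1 hy).2, hyeq.symm⟩

/-- term vanishes at the points of a class-ε cube of V. [folklore] -/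
theorem term_eq_zero {y : Pt d} (hy : y ∈ V) (hc : cls y = ε) (hx : x ∈ cube y) : term ε x V = 0 :=
  le_antisymm ((term_le_infDist hy hc).trans (Metric.infDist_zero_of_mem hx).le) term_nonneg

/-- term = 1 when every class-ε cube of V is at distance ≥ 1. [folklore] -/
theorem term_eq_one (h : ∀ y ∈ V, cls y = ε → 1 ≤ Metric.infDist x (cube y)) : term ε x V = 1 :=
  le_antisymm term_le_one (le_term le_rfl h)

/-- term is antitone in V. [folklore] -/
theorem term_mono (hVW : V ⊆ W) : term ε x W ≤ term ε x V :=
  le_term term_le_one fun _ hy hc => term_le_infDist (hVW hy) hc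

/-- term is 1-Lipschitz in the point. [folklore] -/
theorem term_le_term_add_dist (ε : Fin d → ZMod 2) (x x' : RPt d) (V : Finset (Pt d)) :
    term ε x' V ≤ term ε x V + dist x x' := by
  rcases term_cases ε x V with h1 | ⟨y, hy, hc, heq⟩
  · rw [h1]
    exact term_le_one.trans (le_add_of_nonneg_right dist_nonneg)
  · rw [heq]
    calc term ε x' V ≤ Metric.infDist x' (cube y) := term_le_infDist hy hc
      _ ≤ Metric.infDist x (cube y) + dist x' x := Metric.infDist_le_infDist_add_dist
      _ = Metric.infDist x (cube y) + dist x x' := by rw [dist_comm]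

/-- Φ ≥ 0. [folklore] -/
theorem pot_nonneg : 0 ≤ pot x V := Finset.sum_nonneg fun _ _ => term_nonneg

/-- Φ is (2^d − 1)-Lipschitz between two points at which one common class has term 0. [folklore] -/
theorem pot_le_pot_add {ε₀ : Fin d → ZMod 2} {a b : RPt d} (ha : term ε₀ a V = 0) (hb : term ε₀ b V = 0) :
    pot b V ≤ pot a V + (2 ^ d - 1) * dist a b := by
  classical
  have h : ∀ ε, term ε b V - term ε a V ≤ if ε = ε₀ then 0 else dist a b := by
    intro ε
    split_ifs with hε
    · subst hε
      rw [ha, hb]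
      simp
    · linarith [term_le_term_add_dist ε a b V]
  have hsum : pot b V - pot a V ≤ ∑ ε : Fin d → ZMod 2, (if ε = ε₀ then (0 : ℝ) else dist a b) := by
    rw [pot, pot, ← Finset.sum_sub_distrib]
    exact Finset.sum_le_sum fun ε _ => h ε
  have hval : ∑ ε : Fin d → ZMod 2, (if ε = ε₀ then (0 : ℝ) else dist a b) = (2 ^ d - 1) * dist a b := by
    rw [Finset.sum_ite, Finset.sum_const_zero, zero_add, Finset.sum_const, nsmul_eq_mul]
    congr 1
    have : (Finset.univ.filter fun ε : Fin d → ZMod 2 => ¬ ε = ε₀) = Finset.univ.erase ε₀ := by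
      ext ε
      simp [Finset.mem_erase]
    rw [this, Finset.card_erase_of_mem (Finset.mem_univ _), Finset.card_univ, card_classes,
      Nat.cast_sub Nat.one_le_two_pow]
    simp
  linarith

/-- The starting value: #cubesAt(x) + Φ(x, cubesAt x) = 2^d. [folklore] -/
theorem card_cubesAt_add_pot (x : RPt d) : ((cubesAt x).card : ℝ) + pot x (cubesAt x) = 2 ^ d := by
  classical
  set C := (cubesAt x).image cls with hC
  have hCcard : C.card = (cubesAt x).card := Finset.card_image_of_injOn (cls_injOn_cubesAt x)
  have hterm : ∀ ε, term ε x (cubesAt x) = 1 - (if ε ∈ C then 1 else 0) := by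
    intro ε
    split_ifs with hε
    · obtain ⟨y, hy, hyc⟩ := Finset.mem_image.1 hε
      rw [term_eq_zero hy hyc (mem_cubesAt.1 hy)]
      simp
    · rw [term_eq_one fun y hy hyc => absurd (Finset.mem_image.2 ⟨y, hy, hyc⟩) hε]
      simp
  have hpot : pot x (cubesAt x) = 2 ^ d - C.card := by
    rw [pot, Finset.sum_congr rfl fun ε _ => hterm ε, Finset.sum_sub_distrib, Finset.sum_const, Finset.card_univ,
      card_classes, Finset.sum_boole]
    simp
  rw [hpot, hCcard]
  ring

/-! ## Part 8. Paths — the one-step inequality inside a common cube -/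

/-- ONE STEP: if a, b lie in one lattice cube and V ⊇ cubesAt a, then the number of NEW cubes at b plus the new
potential is at most the old potential plus (2^d − 1)·dist(a, b). [folklore] -/
theorem one_step {z₀ : Pt d} {a b : RPt d} (ha : a ∈ cube z₀) (hb : b ∈ cube z₀) {V : Finset (Pt d)}
    (hV : cubesAt a ⊆ V) :
    ((cubesAt b \ V).card : ℝ) + pot b (V ∪ cubesAt b) ≤ pot a V + (2 ^ d - 1) * dist a b := by
  classical
  set N := cubesAt b \ V with hN
  set V' := V ∪ cubesAt b with hV'
  have hz₀ : z₀ ∈ V := hV (mem_cubesAt.2 ha)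
  have h1 : pot b V ≤ pot a V + (2 ^ d - 1) * dist a b :=
    pot_le_pot_add (term_eq_zero hz₀ rfl ha) (term_eq_zero hz₀ rfl hb)
  set C := N.image cls with hC
  have hCcard : C.card = N.card := by
    refine Finset.card_image_of_injOn ((cls_injOn_cubesAt b).mono ?_)
    intro y hy
    exact Finset.mem_coe.2 (Finset.mem_sdiff.1 (Finset.mem_coe.1 hy)).1
  have hdiff : ∀ ε, term ε b V - term ε b V' = if ε ∈ C then 1 else 0 := by
    intro ε
    split_ifs with hε
    · obtain ⟨y, hyN, hyc⟩ := Finset.mem_image.1 hε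
      obtain ⟨hyb, hyV⟩ := Finset.mem_sdiff.1 hyN
      have hb_y : b ∈ cube y := mem_cubesAt.1 hyb
      have tV : term ε b V = 1 := by
        refine term_eq_one fun y' hy' hc' => ?_
        have hne : y ≠ y' := fun h => hyV (h ▸ hy')
        have hcc : cls y = cls y' := by rw [hyc, hc']
        refine (Metric.le_infDist ⟨corner y', corner_mem_cube y'⟩).2 fun w hw => ?_
        have h3 := three_halves_le_dist_ctr hcc hne hb_y
        have hw' := mem_cube_iff_dist_ctr.1 hw
        linarith [dist_triangle b w (ctr y')]
      have tV' : term ε b V' = 0 := term_eq_zero (Finset.mem_union_right _ hyb) hyc hb_y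
      rw [tV, tV']
      norm_num
    · have hle : term ε b V' ≤ term ε b V := term_mono Finset.subset_union_left
      have hge : term ε b V ≤ term ε b V' := by
        refine le_term term_le_one fun y' hy' hc' => ?_
        rcases Finset.mem_union.1 hy' with h | h
        · exact term_le_infDist h hc'
        · by_cases hyV : y' ∈ V
          · exact term_le_infDist hyV hc'
          · exact absurd (Finset.mem_image.2 ⟨y', Finset.mem_sdiff.2 ⟨h, hyV⟩, hc'⟩) hε
      linarith
  have h2 : pot b V - pot b V' = N.card := by
    rw [pot, pot, ← Finset.sum_sub_distrib, Finset.sum_congr rfl fun ε _ => hdiff ε, Finset.sum_boole, ← hCcard]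
    simp
  linarith

/-! ## Part 9. Paths — one segment: subdivision at the hyperplane crossings -/

/-- Reparametrisation: γ(u) = γ(t) + ((u − t)/(t₁ − t))·(γ(t₁) − γ(t)) for t₁ ≠ t. [folklore] -/
theorem gam_reparam (s : Seg d) {t t₁ : ℝ} (h : t₁ ≠ t) (u : ℝ) :
    gam s u = gam s t + ((u - t) / (t₁ - t)) • (gam s t₁ - gam s t) := by
  have ht : t₁ - t ≠ 0 := sub_ne_zero.2 h
  funext i
  simp only [gam_apply, Pi.add_apply, Pi.smul_apply, Pi.sub_apply, smul_eq_mul]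
  field_simp
  ring

/-- Two points with no integer strictly between their μ-th coordinates, for every μ, lie in a common cube. [folklore] -/
theorem exists_common_cube {u v : RPt d}
    (h : ∀ (i : Fin d) (m : ℤ), ¬ (min (u i) (v i) < m ∧ (m : ℝ) < max (u i) (v i))) :
    ∃ z₀ : Pt d, u ∈ cube z₀ ∧ v ∈ cube z₀ := by
  have key : ∀ i, max (u i) (v i) ≤ (⌊min (u i) (v i)⌋ : ℝ) + 1 := by
    intro i
    by_contra hlt
    push Not at hlt
    refine h i (⌊min (u i) (v i)⌋ + 1) ⟨?_, ?_⟩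
    · push_cast
      exact Int.lt_floor_add_one _
    · push_cast
      exact hlt
  refine ⟨fun i => ⌊min (u i) (v i)⌋, mem_cube.2 fun i => ?_, mem_cube.2 fun i => ?_⟩
  · exact ⟨(Int.floor_le _).trans (min_le_left _ _), (le_max_left _ _).trans (key i)⟩
  · exact ⟨(Int.floor_le _).trans (min_le_right _ _), (le_max_right _ _).trans (key i)⟩

/-- A convex combination of x_μ and y_μ lies between min and max. [folklore] -/
theorem min_le_gam_le_max (x y : RPt d) {t : ℝ} (ht0 : 0 ≤ t) (ht1 : t ≤ 1) (i : Fin d) :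
    min (x i) (y i) ≤ gam (x, y) t i ∧ gam (x, y) t i ≤ max (x i) (y i) := by
  rw [gam_apply]
  simp only
  rcases le_total (x i) (y i) with hxy | hxy
  · rw [min_eq_left hxy, max_eq_right hxy]
    constructor <;> nlinarith
  · rw [min_eq_right hxy, max_eq_left hxy]
    constructor <;> nlinarith

/-- The (finitely many) candidate crossing parameters of the segment [x, y] with the hyperplanes {p_μ ∈ ℤ}. [folklore] -/
def events (x y : RPt d) : Finset ℝ :=
  Finset.univ.biUnion fun i : Fin d =>
    (Finset.Icc ⌊min (x i) (y i)⌋ ⌈max (x i) (y i)⌉).image fun n : ℤ => ((n : ℝ) - x i) / (y i - x i)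

/-- If an integer lies strictly between the μ-th coordinates of γ(t) and γ(t') (0 ≤ t < t' ≤ 1), some candidate
crossing parameter lies strictly between t and t'. [folklore] -/
theorem exists_event {x y : RPt d} {t t' : ℝ} (ht : 0 ≤ t) (htt' : t < t') (ht' : t' ≤ 1) {i : Fin d} {m : ℤ}
    (hm : min (gam (x, y) t i) (gam (x, y) t' i) < m ∧ (m : ℝ) < max (gam (x, y) t i) (gam (x, y) t' i)) :
    ∃ τ ∈ events x y, t < τ ∧ τ < t' := by
  obtain ⟨hm1, hm2⟩ := hm
  have hbt := min_le_gam_le_max x y ht (htt'.le.trans ht') i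
  have hbt' := min_le_gam_le_max x y (ht.trans htt'.le) ht' i
  have hmem : ((m : ℝ) - x i) / (y i - x i) ∈ events x y := by
    rw [events, Finset.mem_biUnion]
    refine ⟨i, Finset.mem_univ _, Finset.mem_image.2 ⟨m, ?_, rfl⟩⟩
    rw [Finset.mem_Icc]
    constructor
    · have h1 : (⌊min (x i) (y i)⌋ : ℝ) < m := by
        have := Int.floor_le (min (x i) (y i))
        have hmin : min (x i) (y i) ≤ min (gam (x, y) t i) (gam (x, y) t' i) := le_min hbt.1 hbt'.1
        linarith
      exact (Int.cast_lt.1 h1).le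
    · have h1 : (m : ℝ) < ⌈max (x i) (y i)⌉ := by
        have := Int.le_ceil (max (x i) (y i))
        have hmax : max (gam (x, y) t i) (gam (x, y) t' i) ≤ max (x i) (y i) := max_le hbt.2 hbt'.2
        linarith
      exact (Int.cast_lt.1 h1).le
  refine ⟨_, hmem, ?_⟩
  rw [gam_apply, gam_apply] at hm1 hm2
  simp only at hm1 hm2
  set c := y i - x i with hc
  rcases lt_trichotomy c 0 with hneg | hzero | hpos
  · -- decreasing coordinate: x i + t' c < x i + t c
    have hlt : x i + t' * c < x i + t * c := by nlinarith
    rw [min_eq_right hlt.le, max_eq_left hlt.le] at *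
    constructor
    · rw [lt_div_iff_of_neg hneg]
      linarith
    · rw [div_lt_iff_of_neg hneg]
      linarith
  · exfalso
    rw [hzero] at hm1 hm2
    simp at hm1 hm2
    linarith
  · have hlt : x i + t * c < x i + t' * c := by nlinarith
    rw [min_eq_left hlt.le, max_eq_right hlt.le] at *
    constructor
    · rw [lt_div_iff₀ hpos]
      linarith
    · rw [div_lt_iff₀ hpos]
      linarith

/-- If no candidate crossing parameter lies strictly between t < t' (in [0, 1]), γ(t) and γ(t') lie in a common cube. [folklore] -/
theorem exists_common_cube_gam {x y : RPt d} {t t' : ℝ} (ht : 0 ≤ t) (htt' : t < t') (ht' : t' ≤ 1)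
    (hno : ∀ τ ∈ events x y, ¬ (t < τ ∧ τ < t')) :
    ∃ z₀ : Pt d, gam (x, y) t ∈ cube z₀ ∧ gam (x, y) t' ∈ cube z₀ := by
  refine exists_common_cube fun i m hm => ?_
  obtain ⟨τ, hτ, h1, h2⟩ := exists_event ht htt' ht' hm
  exact hno τ hτ ⟨h1, h2⟩

/-- Points of the segment between γ(t) and γ(t₁) (t ≤ u ≤ t₁, both ends in one cube z₀) lie only in cubes containing
γ(t) or γ(t₁). [folklore] -/
theorem cubesAt_between {x y : RPt d} {z₀ : Pt d} {t t₁ u : ℝ} (htu : t ≤ u) (hut₁ : u ≤ t₁)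
    (h0 : gam (x, y) t ∈ cube z₀) (h1 : gam (x, y) t₁ ∈ cube z₀) :
    cubesAt (gam (x, y) u) ⊆ cubesAt (gam (x, y) t) ∪ cubesAt (gam (x, y) t₁) := by
  intro z hz
  rw [Finset.mem_union, mem_cubesAt, mem_cubesAt]
  rw [mem_cubesAt] at hz
  rcases eq_or_lt_of_le (htu.trans hut₁) with heq | hlt
  · -- t = t₁: u = t
    have hu : u = t := le_antisymm (heq ▸ hut₁) htu
    left
    rwa [hu] at hz
  · have hne : t₁ ≠ t := ne_of_gt hlt
    rw [gam_reparam (x, y) hne u] at hz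
    have hs0 : 0 ≤ (u - t) / (t₁ - t) := div_nonneg (sub_nonneg.2 htu) (sub_nonneg.2 hlt.le)
    have hs1 : (u - t) / (t₁ - t) ≤ 1 := by
      rw [div_le_one (sub_pos.2 hlt)]
      linarith
    exact mem_cube_endpoints h0 h1 hs0 hs1 hz

/-- ONE SEGMENT, from parameter t on (induction on the number of candidate crossings ahead): starting from V ⊇
cubesAt γ(t), adding the cubes met by γ([t, 1]) costs at most Φ-decrease + (2^d − 1)·(1 − t)·|s|. [folklore] -/
theorem seg_aux (x y : RPt d) (n : ℕ) : ∀ (t : ℝ), 0 ≤ t → t ≤ 1 →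
    ((events x y).filter fun τ => t < τ ∧ τ < 1).card ≤ n →
    ∀ V : Finset (Pt d), cubesAt (gam (x, y) t) ⊆ V →
      ∃ V' : Finset (Pt d), V ⊆ V' ∧ cubesAt y ⊆ V' ∧
        (∀ u ∈ Set.Icc t 1, cubesAt (gam (x, y) u) ⊆ V') ∧
        (V'.card : ℝ) + pot y V' ≤ V.card + pot (gam (x, y) t) V + (2 ^ d - 1) * ((1 - t) * dist x y) := by
  classical
  -- the direct finish, used in both cases
  have finish : ∀ (t : ℝ), 0 ≤ t → t ≤ 1 → (∀ τ ∈ events x y, ¬ (t < τ ∧ τ < 1)) →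
      ∀ V : Finset (Pt d), cubesAt (gam (x, y) t) ⊆ V →
        ∃ V' : Finset (Pt d), V ⊆ V' ∧ cubesAt y ⊆ V' ∧
          (∀ u ∈ Set.Icc t 1, cubesAt (gam (x, y) u) ⊆ V') ∧
          (V'.card : ℝ) + pot y V' ≤ V.card + pot (gam (x, y) t) V + (2 ^ d - 1) * ((1 - t) * dist x y) := by
    intro t ht0 ht1 hno V hV
    -- a common cube for γ(t) and y = γ(1)
    have hcom : ∃ z₀ : Pt d, gam (x, y) t ∈ cube z₀ ∧ gam (x, y) 1 ∈ cube z₀ := by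
      rcases eq_or_lt_of_le ht1 with rfl | hlt
      · exact ⟨zOf (gam (x, y) 1), mem_cube_zOf _, mem_cube_zOf _⟩
      · exact exists_common_cube_gam ht0 hlt le_rfl hno
    obtain ⟨z₀, hz0, hz1⟩ := hcom
    have hy1 : gam (x, y) 1 = y := B13Geometry236Printed.gam_one (x, y)
    refine ⟨V ∪ cubesAt y, Finset.subset_union_left, Finset.subset_union_right, ?_, ?_⟩
    · intro u hu
      have := cubesAt_between hu.1 hu.2 hz0 hz1
      rw [hy1] at this
      exact this.trans (Finset.union_subset_union hV subset_rfl)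
    · have hstep := one_step hz0 hz1 hV
      rw [hy1] at hstep
      have hcard : ((V ∪ cubesAt y).card : ℝ) = V.card + (cubesAt y \ V).card := by
        rw [← Finset.union_sdiff_self_eq_union, Finset.card_union_of_disjoint Finset.disjoint_sdiff]
        push_cast
        ring
      have hdist : dist (gam (x, y) t) (gam (x, y) 1) = (1 - t) * dist x y := by
        rw [B13Geometry236Printed.dist_gam_gam, abs_of_nonneg (by linarith)]
      rw [hy1] at hdist
      rw [hcard, ← hdist]
      linarith
  induction n with
  | zero =>
    intro t ht0 ht1 hcard V hV
    refine finish t ht0 ht1 (fun τ hτ hτt => ?_) V hV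
    have : τ ∈ (events x y).filter fun τ => t < τ ∧ τ < 1 := Finset.mem_filter.2 ⟨hτ, hτt⟩
    rw [Finset.card_eq_zero.1 (Nat.le_zero.1 hcard)] at this
    simp at this
  | succ n ih =>
    intro t ht0 ht1 hcard V hV
    set F := (events x y).filter fun τ => t < τ ∧ τ < 1 with hF
    by_cases hFe : F = ∅
    · refine finish t ht0 ht1 (fun τ hτ hτt => ?_) V hV
      have : τ ∈ F := Finset.mem_filter.2 ⟨hτ, hτt⟩
      rw [hFe] at this
      simp at this
    · have hFne : F.Nonempty := Finset.nonempty_iff_ne_empty.2 hFe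
      set t' := F.min' hFne with ht'
      have ht'F : t' ∈ F := Finset.min'_mem F hFne
      obtain ⟨ht'E, htt', ht'1⟩ := Finset.mem_filter.1 ht'F
      -- no candidate crossing strictly between t and t'
      have hno : ∀ τ ∈ events x y, ¬ (t < τ ∧ τ < t') := by
        rintro τ hτ ⟨h1, h2⟩
        have hτF : τ ∈ F := Finset.mem_filter.2 ⟨hτ, h1, h2.trans ht'1⟩
        have := F.min'_le τ hτF
        linarith
      obtain ⟨z₀, hz0, hz1⟩ := exists_common_cube_gam ht0 htt' ht'1.le hno
      -- one step to t'
      have hstep := one_step hz0 hz1 hV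
      set V₁ := V ∪ cubesAt (gam (x, y) t') with hV₁
      have hV₁' : cubesAt (gam (x, y) t') ⊆ V₁ := Finset.subset_union_right
      -- fewer crossings ahead of t'
      have hcard' : ((events x y).filter fun τ => t' < τ ∧ τ < 1).card ≤ n := by
        have hsub : ((events x y).filter fun τ => t' < τ ∧ τ < 1) ⊆ F.erase t' := by
          intro τ hτ
          obtain ⟨hτE, h1, h2⟩ := Finset.mem_filter.1 hτ
          exact Finset.mem_erase.2 ⟨ne_of_gt h1, Finset.mem_filter.2 ⟨hτE, htt'.trans h1, h2⟩⟩
        have := Finset.card_le_card hsub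
        rw [Finset.card_erase_of_mem ht'F] at this
        omega
      obtain ⟨V', hV₁V', hyV', hcov, hle⟩ := ih t' (ht0.trans htt'.le) ht'1.le hcard' V₁ hV₁'
      refine ⟨V', Finset.subset_union_left.trans hV₁V', hyV', ?_, ?_⟩
      · intro u hu
        rcases le_total u t' with hut' | hut'
        · exact (cubesAt_between hu.1 hut' hz0 hz1).trans
            ((Finset.union_subset_union hV subset_rfl).trans hV₁V')
        · exact hcov u ⟨hut', hu.2⟩
      · have hcardV₁ : (V₁.card : ℝ) = V.card + (cubesAt (gam (x, y) t') \ V).card := by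
          rw [hV₁, ← Finset.union_sdiff_self_eq_union, Finset.card_union_of_disjoint Finset.disjoint_sdiff]
          push_cast
          ring
        have hdist : dist (gam (x, y) t) (gam (x, y) t') = (t' - t) * dist x y := by
          rw [B13Geometry236Printed.dist_gam_gam, abs_of_nonneg (by linarith)]
        rw [hdist] at hstep
        rw [hcardV₁] at hle
        have hD : 0 ≤ dist x y := dist_nonneg
        nlinarith [hstep, hle]

/-- ONE SEGMENT: starting from V ⊇ cubesAt x, adding every cube met by the segment [x, y] gives V' ⊇ cubesAt y with
#V' + Φ(y, V') ≤ #V + Φ(x, V) + (2^d − 1)·dist(x, y). [folklore] -/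
theorem seg_step (x y : RPt d) (V : Finset (Pt d)) (hV : cubesAt x ⊆ V) :
    ∃ V' : Finset (Pt d), V ⊆ V' ∧ cubesAt y ⊆ V' ∧ (∀ p ∈ segment ℝ x y, cubesAt p ⊆ V') ∧
      (V'.card : ℝ) + pot y V' ≤ V.card + pot x V + (2 ^ d - 1) * dist x y := by
  classical
  have hx : gam (x, y) 0 = x := B13Geometry236Printed.gam_zero (x, y)
  obtain ⟨V', h1, h2, h3, h4⟩ := seg_aux x y _ 0 le_rfl zero_le_one le_rfl V (by rw [hx]; exact hV)
  refine ⟨V', h1, h2, fun p hp => ?_, ?_⟩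
  · have hp' : p ∈ gam (x, y) '' Set.Icc (0 : ℝ) 1 := by
      rw [← segment_eq_image_gam (x, y)]
      exact hp
    obtain ⟨u, hu, rfl⟩ := hp'
    exact h3 u hu
  · rw [hx] at h4
    simpa using h4

/-! ## Part 10. Paths — the sharp count #Y ≤ (2^d − 1)·|T| + 2^d -/

/-- A polygonal PATH: consecutive segments share an endpoint (s_k.2 = s_{k+1}.1). [folklore] -/
def IsPath : List (Seg d) → Prop
  | [] => True
  | [_] => True
  | s :: s' :: T => s.2 = s'.1 ∧ IsPath (s' :: T)

/-- Along a path from V ⊇ cubesAt(start): all met cubes are collected at cost ≤ Φ(start) + (2^d − 1)·|path|. [folklore] -/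
theorem path_aux : ∀ (T : List (Seg d)) (s : Seg d), IsPath (s :: T) → ∀ V : Finset (Pt d), cubesAt s.1 ⊆ V →
    ∃ V' : Finset (Pt d), V ⊆ V' ∧ (∀ p ∈ carrier (s :: T), cubesAt p ⊆ V') ∧
      (V'.card : ℝ) ≤ V.card + pot s.1 V + (2 ^ d - 1) * len (s :: T)
  | [], s, _, V, hV => by
    obtain ⟨V', hVV', -, hcov, hle⟩ := seg_step s.1 s.2 V hV
    refine ⟨V', hVV', ?_, ?_⟩
    · intro p hp
      rw [carrier_cons, carrier_nil, Set.union_empty] at hp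
      exact hcov p hp
    · have := pot_nonneg (x := s.2) (V := V')
      simp only [len_cons, len_nil, add_zero]
      linarith
  | s' :: T, s, hP, V, hV => by
    obtain ⟨h12, hP'⟩ := hP
    obtain ⟨V₁, hVV₁, hy, hcov₁, hle₁⟩ := seg_step s.1 s.2 V hV
    obtain ⟨V', hV₁V', hcov', hle'⟩ := path_aux T s' hP' V₁ (h12 ▸ hy)
    refine ⟨V', hVV₁.trans hV₁V', ?_, ?_⟩
    · intro p hp
      rw [carrier_cons] at hp
      rcases hp with hp | hp
      · exact (hcov₁ p hp).trans hV₁V'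
      · exact hcov' p hp
    · have hle₁' : (V₁.card : ℝ) + pot s'.1 V₁ ≤ V.card + pot s.1 V + (2 ^ d - 1) * dist s.1 s.2 := by
        rw [← h12]
        exact hle₁
      have := pot_nonneg (x := s'.1) (V := V₁)
      simp only [len_cons] at hle' ⊢
      have hlen := len_nonneg T
      linarith

/-- THE SHARP PATH COUNT: a polygonal path meets at most (2^d − 1)·|T| + 2^d unit cubes (sup metric) — the slope
2^d − 1 is the floor of `B16.SupCountFloor.count_floor`, attained by the unit diagonal. [folklore] -/
theorem card_le_of_isPath {Y : Finset (Pt d)} {s : Seg d} {T : List (Seg d)} (hP : IsPath (s :: T))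
    (hY : ∀ y ∈ Y, (carrier (s :: T) ∩ cube y).Nonempty) :
    (Y.card : ℝ) ≤ (2 ^ d - 1) * len (s :: T) + 2 ^ d := by
  obtain ⟨V', -, hcov, hle⟩ := path_aux T s hP (cubesAt s.1) subset_rfl
  have hYV : Y ⊆ V' := fun y hy => by
    obtain ⟨p, hp, hpy⟩ := hY y hy
    exact hcov p hp (mem_cubesAt.2 hpy)
  have h0 := card_cubesAt_add_pot s.1
  calc (Y.card : ℝ) ≤ V'.card := by exact_mod_cast Finset.card_le_card hYV
    _ ≤ (cubesAt s.1).card + pot s.1 (cubesAt s.1) + (2 ^ d - 1) * len (s :: T) := hle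
    _ = (2 ^ d - 1) * len (s :: T) + 2 ^ d := by rw [h0]; ring

/-- THE SHARP PATH COUNT, Steiner form: a Steiner-admissible PATH for Y has #Y ≤ (2^d − 1)·|T| + 2^d. [folklore] -/
theorem card_le_of_isPath_sAdmissible {Y : Finset (Pt d)} {T : List (Seg d)} (hP : IsPath T)
    (hT : SAdmissible Y T) : (Y.card : ℝ) ≤ (2 ^ d - 1) * len T + 2 ^ d := by
  cases T with
  | nil =>
    have := hT.connected.nonempty
    simp at this
  | cons s T => exact card_le_of_isPath hP hT.meets

/-- In d = 4 a path meets at most 15·|T| + 16 cubes (printed slope behind [Balaban1989LargeFieldII] (1.93): 24). [folklore] -/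
theorem card_le_of_isPath_four {Y : Finset (Pt 4)} {T : List (Seg 4)} (hP : IsPath T) (hT : SAdmissible Y T) :
    (Y.card : ℝ) ≤ 15 * len T + 16 := by
  have := card_le_of_isPath_sAdmissible hP hT
  norm_num at this
  linarith

/-- SHARPNESS FOR PATHS: the unit diagonal (a one-segment path) meets 2^{d+1} − 1 = (2^d − 1)·1 + 2^d cubes, so no
constant below 2^d − 1 is valid even for paths (d ≥ 1); with `card_le_of_isPath_sAdmissible` the optimal path slope
is exactly 2^d − 1. [folklore] -/
theorem path_slope_sharp (hd : 0 < d) {c : ℝ}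
    (h : ∀ (Y : Finset (Pt d)) (T : List (Seg d)), IsPath T → SAdmissible Y T → (Y.card : ℝ) ≤ c * len T + 2 ^ d) :
    (2 : ℝ) ^ d - 1 ≤ c := by
  have h1 := h (SupCountFloor.diagCubes d) [SupCountFloor.diagSeg d] (by simp [IsPath])
    (SupCountFloor.sAdmissible_diag (d := d))
  rw [SupCountFloor.card_diagCubes, SupCountFloor.len_diag hd, Nat.cast_sub Nat.one_le_two_pow] at h1
  push_cast at h1
  rw [pow_succ] at h1
  linarith

end

end Literature.MathematicalPhysics.QuantumFieldTheory.Balaban1983to89.B16.SupCountCeiling
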